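import Literature.NumberTheory.EllipticCurves.KrizLi2019.EisensteinHeegnerLog
import Literature.NumberTheory.EllipticCurves.KrizLi2019.SexticTwistBSDThree
import HarnessLib

/-!
# Kriz–Li 2019, Theorem 9.4 (first assertion) for a GENERAL elliptic curve with a rational `3`-isogeny — a Heegner field `K` with
# `d_K` odd and `h₃(d₀ d_K) = 1` EXISTS — and §8 (Lemma 8.2 / Corollary 8.3 with the class number formula (35)) at `p = 3`:
# `3 ∤ h(K_{ψ₀ε_K})·h(K_{ψ₀⁻¹ω})` gives hypothesis (4) of Theorem 7.1

Trunk `Literature/NumberTheory/EllipticCurves`, story `KrizLi2019/` (D. Kriz, C. Li, *Goldfeld's conjecture and congruences between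
Heegner points*, Forum Math. Sigma **7** (2019) e15, 80 pp., doi 10.1017/fms.2019.9, open access, REFEREED; bib `KrizLi2019`; store
`paper:doi-10-1017-fms-2019-9` (s2orc text, §§8–9 = chunks p0023–p0027) and the authors' LaTeX of arXiv:1609.06687v3 `Eisenstein.tex`
(held: `run/shared/lean/b2b/bsd-rank1-residual/b2b-bsdres-harvest-2/src/Eisenstein.tex`; §8 = ll. 815–867, Theorem 9.4 =
`\label{twistpositiveproportion}` ll. 931–975 with proof ll. 977–1033), from which the statements below are transcribed).  Sibling of
`HeegnerFieldSupply.lean` (cell `b2b-bsdres`, which typed Theorem 9.4's first assertion for the SEXTIC twists only, noting «the general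
`E` of Theorem 9.4: the tree has no `ψ`-of-a-`3`-isogeny vocabulary to state (1)–(5) for a general curve») — that vocabulary now exists:
`EisensteinHeegnerLog.lean` (Thm. 1.20 = Thm. 7.1, cell `bsd-cm`) reads «`E[p]` reducible, `E[p]^{ss} ≅ 𝔽_p(ψ) ⊕ 𝔽_p(ψ⁻¹ω)`» by
TRACES OF FROBENIUS on a primitive `ψ : DirichletCharacter ℚ_[p] f` and the Teichmüller `ω`, and this file uses it VERBATIM at `p = 3`.
Cell `bsd-schneider-ideate`, seat `bsd-schneider-door-c5` (prover, gen 36); consumer: the K1 door's Kriz–Li road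
(`Summits/…/Theorems/SchneiderFreeAdditiveX3KrizLiLocusSupplyThree.lean`, filed with this file), which needs, for a curve `W/ℚ` with the
character data of Thm. 7.1 at `p = 3`, the EXISTENCE of a Heegner field `K` carrying hypothesis (4) — Theorem 9.4 supplies `K` with
`h₃(d₀ d_K) = 1`, and §8 converts `3 ∤ h·h` into (4).  TWO named facts (`def … : Prop`, nothing asserted; both PUBLISHED, refereed),
no definition with parameters beyond the tree's, no instance, no notation, no `sorry`.

## The printed statements (verbatim; TeX source, journal wording where the s2orc text is legible)

**Theorem 9.4** (journal p0026: «THEOREM 9.4. Suppose `E/ℚ` is any elliptic curve of conductor `N = N_split N_nonsplit N_add` whose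
mod `3` Galois representation `E[3]` is reducible and `E[3]^{ss} ≅ 𝔽₃(ψ) ⊕ 𝔽₃(ψ⁻¹ω)`. Let `d` be the fundamental discriminant
corresponding to the quadratic character `ψ`. Suppose that»; TeX ll. 933–937:)
> (1) `ψ(3) ≠ 1` and `(ψ⁻¹ω)(3) ≠ 1`; (2) `ℓ ≠ 3, ℓ ∣ N_split` implies `ψ(ℓ) = −1`; (3) `ℓ ≠ 3, ℓ ∣ N_nonsplit` implies `ψ(ℓ) = 1`;
> (4) `ℓ ∣ N_add, ℓ ≡ 1 (mod 3)` implies `ψ(ℓ) = −1` or `0`; (5) `ℓ ∣ N_add, ℓ ≡ 2 (mod 3)` implies `ψ(ℓ) = 0`.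
> Let `d₀ := d` (`d > 0`); `−3d` (`d < 0, d ≢ 0 (mod 3)`); `−d/3` (`d < 0, d ≡ 0 (mod 3)`) … Then a proportion of at least (39) of all
> imaginary quadratic fields `K` have the following properties: (1) `d_K` is odd, (2) `K` satisfies the Heegner hypothesis with respect to
> `3N`, (3) `h₃(d₀ d_K) = 1`.  If furthermore, we impose the assumption on `E` that (6) `h₃(−3d) = 1` if `ψ(−1) = 1`, and `h₃(d) = 1` if
> `ψ(−1) = −1`, then at least the same proportion (39) of all imaginary quadratic fields `K` have: (1) `d_K` is odd, (2) `K` satisfies the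
> Heegner hypothesis with respect to `3N`, and (3) the Heegner point `P ∈ E(K)` is non-torsion.
(«`h₃(D)` denotes the `3`-primary part of the class number of `ℚ(√D)`», §9 before Def. 9.1.)  Its engine is Nakagawa–Horie, Proc. AMS 104
(1988) Thm. 1 (= Thm. 9.2) with Taya, Proc. AMS 128 (2000) (= Prop. 9.3) — refereed, in print.

**§8** (journal p0023–p0024; TeX ll. 818–867): «When `p = 3` and `E` has a `3`-isogeny defined over `ℚ`, all Dirichlet characters in
Theorem 7.1 are quadratic. Note that for an odd quadratic character `ψ` over `ℚ`, by the analytic class number formula we have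
(35) `B_{1,ψ} = −2 h_{K_ψ} / |𝓞_{K_ψ}^×|` where `K_ψ` is the imaginary quadratic field associated with `ψ`. So the `3`-indivisibility
criteria of the theorem becomes a question of `3`-indivisibility of quadratic class numbers.» … «**Lemma 8.2.** Suppose `ψ : Gal(ℚ̄/ℚ) → μ_{p−1}`
is a Dirichlet character and `K` is an imaginary quadratic field such that `f(ψ)` is prime to `d_K` and `p ∤ d_K`. As long as `ψ ≠ 1` or
`ω`, we have `p ∤ h⁻_{K_{ψ₀ε_K}}·h⁻_{K_{ψ₀⁻¹ω}} ⟹ p ∤ B_{1,ψ₀ε_K}·B_{1,ψ₀⁻¹ω}`.» «**Corollary 8.3.** Suppose we are in the setting of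
Theorem 7.1. Then `p ∤ h⁻_{K_{ψ₀ε_K}}·h⁻_{K_{ψ₀⁻¹ω}}` implies condition (4) of the theorem. Proof. Condition (1) in the statement of
Theorem 7.1 in particular implies `ψ ≠ 1` or `ω`. Now the statement follows from Lemma 8.2.»  (For an odd quadratic `χ`, `K_χ` is
imaginary quadratic and `h⁻_{K_χ} = h_{K_χ}/h_ℚ = h(K_χ)`; condition (4) of Thm. 7.1 is «`p ∤ B_{1,ψ₀⁻¹ε_K}·B_{1,ψ₀ω⁻¹}`», and for
quadratic characters `χ⁻¹ = χ`.)

## Transcription (tree vocabulary; every printed hypothesis a binder; `p = 3` throughout)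

* `E` = a GLOBALLY MINIMAL model `W/ℚ`, `N = W.conductorNorm ℤ`; «`E[3]` reducible, `E[3]^{ss} ≅ 𝔽₃(ψ) ⊕ 𝔽₃(ψ⁻¹ω)`» EXACTLY as
  `thm120_padicLogHeegner_unit_of_bernoulli` reads it: `ψ : DirichletCharacter ℚ_[3] f` primitive, `ω : DirichletCharacter ℚ_[3] 3` with
  `IsTeichmullerCharacter ω` (at `p = 3`: `ω = χ_{−3}`), and the trace form `‖a_ℓ(W) − (ψ(ℓ) + ψ⁻¹(ℓ)ω(ℓ))‖₃ < 1` at the primes `ℓ ∤ 3N`.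
  «quadratic»: `ψ ^ 2 = 1` (its values on units are `±1`).
* «the fundamental discriminant `d` corresponding to `ψ`»: for a primitive quadratic Dirichlet character of conductor `f`, `d = ψ(−1)·f`
  (`|d| = f`, `sign d = ψ(−1)`; Cox §1.C / Montgomery–Vaughan §9.3) — so `d = f` when `ψ` is even (`DirichletCharacter.Even`: `ψ(−1) = 1`)
  and `d = −f` when `ψ` is odd.  Hence `d₀ d_K` generates the quadratic field `ℚ(√(f·d_K))` for `ψ` even (`d₀ = d = f`) and `ℚ(√(3 f d_K))`
  for `ψ` odd (`d = −f`: `d₀ = −3d = 3f` if `3 ∤ d`, `d₀ = −d/3 = f/3` if `3 ∣ d`, and `ℚ(√((f/3)·d_K)) = ℚ(√(3 f d_K))`), and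
  «`h₃(D) = 1`» is the tree's `ThreeClassNumberTrivial D` (`SexticTwistBSDThree.lean`: `3 ∤` the class number of every quadratic field
  in which `D` is a square — a predicate depending only on `ℚ(√D)`), as in the sextic sibling.
* (1) as in Thm. 1.20's transcription: `ψ ((3 : ℕ) : ZMod f) ≠ 1`, `primVal (invMulOmega ψ ω) 3 ≠ 1`.  (2)/(3): «`ℓ ∣ N_split`» =
  `W.HasSplitMultiplicativeReductionAtPrime ℓ`, «`ℓ ∣ N_nonsplit`» = multiplicative and not split; (4)/(5): «`ℓ ∣ N_add`» =
  `¬ HasGoodReductionAtPrime ℓ ∧ ¬ HasMultiplicativeReductionAtPrime ℓ` (the tree's `Rank1Residual.Addv`, inlined), `ℓ ≡ 1, 2 (mod 3)` as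
  `ℓ % 3 = 1, 2`; «`ψ(ℓ)`» = `ψ (ℓ : ZMod f)` (Mathlib's `MulChar` is already extended by `0` off the units, the paper's convention §2).
* Conclusion of Thm. 9.4, EXISTENCE form (weaker than the printed positive proportion; the authors' own reading, Remark 9.6: «for each
  such `d` there is at least one `K`»): `∃ K`, `IsImaginaryQuadratic K`, `Odd (NumberField.discr K)`,
  `SatisfiesHeegnerHypothesis (3 * N) K`, and (3) by the parity of `ψ` as above.  NOT transcribed: the proportion (39), the second assertion
  (non-torsion of the Heegner point under (6)) — `TODO(general form)` —, and the `GL₂`-type abelian varieties of arXiv v3.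
* §8 at `p = 3` (second fact): the hypotheses of Lemma 8.2 / Cor. 8.3 — `ψ` quadratic primitive of conductor `f`, «`ψ ≠ 1, ω`» in the form
  Cor. 8.3 uses it (hypothesis (1) of Thm. 7.1), `K` imaginary quadratic with `(f, d_K) = 1` and `3 ∤ d_K`, `ε_K` its Kronecker character
  (`IsKroneckerCharacterOf`, the binder of Thm. 1.20) — and «`3 ∤ h(K_{ψ₀ε_K})·h(K_{ψ₀⁻¹ω})`» rendered through (35) and `d = ψ(−1) f`:
  for `ψ` EVEN, `ψ₀ = ψ`, `K_{ψ₀ε_K} = ℚ(√(d·d_K)) = ℚ(√(f d_K))` and `K_{ψ₀⁻¹ω} = K_{ψω} = ℚ(√(−3d)) = ℚ(√(−3f))`; for `ψ` ODD, `ψ₀ = ψε_K`,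
  `K_{ψ₀ε_K} = K_ψ = ℚ(√d) = ℚ(√(−f))` and `K_{ψ₀⁻¹ω} = K_{ψε_Kω} = ℚ(√(−3 d d_K)) = ℚ(√(3 f d_K))` (products of quadratic characters multiply
  their discriminants modulo squares); each «`3 ∤ h`» as `ThreeClassNumberTrivial` of that radicand (for an imaginary quadratic field
  `h⁻ = h`).  Conclusion = hypothesis (4) of Thm. 7.1 LITERALLY as `thm120_…` consumes it:
  `¬ ‖bernoulliOnePrim (bernoulliCharOne ψ εK) · bernoulliOnePrim (bernoulliCharTwo ψ εK ω)‖₃ ≤ 3⁻¹`.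
  These are exactly Theorem 9.4's (3) `h₃(d₀d_K) = 1` and (6) (`h₃(−3d) = 1` if `ψ` even, `h₃(d) = 1` if `ψ` odd) — the pair the proof of
  Theorem 9.4 feeds to Theorem 7.1 («for all `K` as above, `E`, `p = 3` and `K` satisfy all the assumptions of Theorem 7.1 (see
  Remark 7.3)», TeX l. 1031 / journal p0026).

No `_holds` is to be expected soon (Davenport–Heilbronn / Nakagawa–Horie densities; the analytic class number formula for quadratic
fields is not in Mathlib).  References: [KrizLi2019] Thm. 9.4, Rem. 9.6, §8 (35), Lemma 8.1, Lemma 8.2, Cor. 8.3, Thm. 7.1, Rem. 7.3;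
J. Nakagawa, K. Horie, Proc. AMS 104 (1988) Thm. 1; H. Taya, Proc. AMS 128 (2000); L. Washington, *Cyclotomic Fields*, Thm. 4.17
[Washington1997]; D. Cox, *Primes of the form x² + ny²*, §1.C Lemma 1.14 [Cox2013].
-/

noncomputable section

open scoped Classical

open WeierstrassCurve NumberField Literature.NumberTheory.EllipticCurves

namespace Literature.NumberTheory.EllipticCurves.KrizLi2019

/-- **Kriz–Li, Forum Math. Sigma 7 (2019) e15, Theorem 9.4 (first assertion), for a general elliptic curve `E/ℚ` with a rational
`3`-isogeny** (= arXiv:1609.06687v3 `twistpositiveproportion`, ll. 931–964): «Suppose `E/ℚ` is any elliptic curve of conductor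
`N = N_split N_nonsplit N_add` whose mod `3` Galois representation `E[3]` is reducible and `E[3]^{ss} ≅ 𝔽₃(ψ) ⊕ 𝔽₃(ψ⁻¹ω)`. Let `d` be the
fundamental discriminant corresponding to the quadratic character `ψ`. Suppose that (1) `ψ(3) ≠ 1` and `(ψ⁻¹ω)(3) ≠ 1`; (2) `ℓ ≠ 3,
ℓ ∣ N_split` implies `ψ(ℓ) = −1`; (3) `ℓ ≠ 3, ℓ ∣ N_nonsplit` implies `ψ(ℓ) = 1`; (4) `ℓ ∣ N_add, ℓ ≡ 1 (mod 3)` implies `ψ(ℓ) = −1` or `0`;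
(5) `ℓ ∣ N_add, ℓ ≡ 2 (mod 3)` implies `ψ(ℓ) = 0`. … Then a proportion of at least (39) of all imaginary quadratic fields `K` have the
following properties: (1) `d_K` is odd, (2) `K` satisfies the Heegner hypothesis with respect to `3N`, (3) `h₃(d₀ d_K) = 1`», `d₀ = d`
(`d > 0`), `−3d` (`d < 0`, `3 ∤ d`), `−d/3` (`d < 0`, `3 ∣ d`) — transcribed in EXISTENCE form (weaker than print; Remark 9.6).  Tree
rendering (module docstring): `W` globally minimal, `N = W.conductorNorm ℤ`; the residual hypothesis by traces of Frobenius on a primitive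
quadratic `ψ : DirichletCharacter ℚ_[3] f` and the Teichmüller `ω` exactly as in `thm120_padicLogHeegner_unit_of_bernoulli`; `d = ψ(−1)·f`,
so (3) reads `ThreeClassNumberTrivial (f·d_K)` for `ψ` even and `ThreeClassNumberTrivial (3·f·d_K)` for `ψ` odd (the field `ℚ(√(d₀ d_K))`
in every sub-case).  Named fact (PUBLISHED, refereed); nothing asserted; users take `(h : thm94_exists_heegnerField_h3_of_threeIsogeny)`.
-- TODO(general form): the proportion (39); the second assertion (under (6) the Heegner point `P ∈ E(K)` is non-torsion); the
`GL₂`-type abelian varieties of arXiv:1609.06687v3.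
[cite: KrizLi2019, Thm. 9.4 (first assertion) and Rem. 9.6 (Forum Math. Sigma 7 (2019) e15, §9; = arXiv:1609.06687v3 ll. 931–964, 1133)] -/
def thm94_exists_heegnerField_h3_of_threeIsogeny : Prop :=
  ∀ (W : WeierstrassCurve ℚ) [W.IsElliptic] [W.IsGloballyMinimal]
    (f : ℕ) [NeZero f] (ψ : DirichletCharacter ℚ_[3] f) (ω : DirichletCharacter ℚ_[3] 3),
    ψ.IsPrimitive → ψ ^ 2 = 1 → IsTeichmullerCharacter ω →
    -- `E[3]` reducible with `E[3]^{ss} ≅ 𝔽₃(ψ) ⊕ 𝔽₃(ψ⁻¹ω)`: traces of Frobenius at the primes `ℓ ∤ 3N`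
    (∀ ℓ : ℕ, ℓ.Prime → ¬ (ℓ ∣ 3 * W.conductorNorm ℤ) →
      ‖((W.LFunction ℓ : ℤ) : ℚ_[3]) - (ψ (ℓ : ZMod f) + ψ⁻¹ (ℓ : ZMod f) * ω (ℓ : ZMod 3))‖ < 1) →
    -- (1) `ψ(3) ≠ 1` and `(ψ⁻¹ω)(3) ≠ 1`
    ψ ((3 : ℕ) : ZMod f) ≠ 1 → primVal (invMulOmega ψ ω) 3 ≠ 1 →
    -- (2) `ℓ ≠ 3`, `ℓ ∣ N_split` implies `ψ(ℓ) = −1`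
    (∀ ℓ : ℕ, (hℓ : ℓ.Prime) → ℓ ≠ 3 →
      (haveI := Fact.mk hℓ; W.HasSplitMultiplicativeReductionAtPrime ℓ) → ψ (ℓ : ZMod f) = -1) →
    -- (3) `ℓ ≠ 3`, `ℓ ∣ N_nonsplit` implies `ψ(ℓ) = 1`
    (∀ ℓ : ℕ, (hℓ : ℓ.Prime) → ℓ ≠ 3 →
      (haveI := Fact.mk hℓ;
        W.HasMultiplicativeReductionAtPrime ℓ ∧ ¬ W.HasSplitMultiplicativeReductionAtPrime ℓ) → ψ (ℓ : ZMod f) = 1) →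
    -- (4) `ℓ ∣ N_add`, `ℓ ≡ 1 (mod 3)` implies `ψ(ℓ) = −1` or `0`
    (∀ ℓ : ℕ, (hℓ : ℓ.Prime) → ℓ % 3 = 1 →
      (haveI := Fact.mk hℓ; ¬ W.HasGoodReductionAtPrime ℓ ∧ ¬ W.HasMultiplicativeReductionAtPrime ℓ) →
      ψ (ℓ : ZMod f) = -1 ∨ ψ (ℓ : ZMod f) = 0) →
    -- (5) `ℓ ∣ N_add`, `ℓ ≡ 2 (mod 3)` implies `ψ(ℓ) = 0`
    (∀ ℓ : ℕ, (hℓ : ℓ.Prime) → ℓ % 3 = 2 →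
      (haveI := Fact.mk hℓ; ¬ W.HasGoodReductionAtPrime ℓ ∧ ¬ W.HasMultiplicativeReductionAtPrime ℓ) →
      ψ (ℓ : ZMod f) = 0) →
    ∃ (K : Type) (_ : Field K) (_ : NumberField K),
      IsImaginaryQuadratic K ∧
        -- (1) `d_K` is odd
        Odd (NumberField.discr K) ∧
        -- (2) the Heegner hypothesis with respect to `3N`
        SatisfiesHeegnerHypothesis (3 * W.conductorNorm ℤ) K ∧
        -- (3) `h₃(d₀ d_K) = 1`: `ψ` even, `d = f`, `d₀ d_K = f·d_K`; `ψ` odd, `d = −f`, `ℚ(√(d₀ d_K)) = ℚ(√(3 f d_K))`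
        (ψ.Even → ThreeClassNumberTrivial ((f : ℤ) * NumberField.discr K)) ∧
        (ψ.Odd → ThreeClassNumberTrivial (3 * (f : ℤ) * NumberField.discr K))

/-- **Kriz–Li 2019, §8 at `p = 3`: Lemma 8.2 / Corollary 8.3 with the class number formula (35)** (journal §8; = arXiv:1609.06687v3
ll. 818–867): «When `p = 3` … all Dirichlet characters in Theorem 7.1 are quadratic … (35) `B_{1,ψ} = −2h_{K_ψ}/|𝓞_{K_ψ}^×|` where `K_ψ` is
the imaginary quadratic field associated with `ψ`. So the `3`-indivisibility criteria of the theorem becomes a question of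
`3`-indivisibility of quadratic class numbers.» «Lemma 8.2. Suppose `ψ` is a Dirichlet character and `K` is an imaginary quadratic field
such that `f(ψ)` is prime to `d_K` and `p ∤ d_K`. As long as `ψ ≠ 1` or `ω`, we have `p ∤ h⁻_{K_{ψ₀ε_K}}·h⁻_{K_{ψ₀⁻¹ω}} ⟹
p ∤ B_{1,ψ₀ε_K}·B_{1,ψ₀⁻¹ω}`.» «Corollary 8.3. Suppose we are in the setting of Theorem 7.1. Then `p ∤ h⁻_{K_{ψ₀ε_K}}·h⁻_{K_{ψ₀⁻¹ω}}`
implies condition (4) of the theorem» (proof: «Condition (1) … implies `ψ ≠ 1` or `ω`»).  Tree rendering at `p = 3` (module docstring):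
`ψ : DirichletCharacter ℚ_[3] f` primitive and quadratic, `ω` Teichmüller, «`ψ ≠ 1, ω`» through hypothesis (1) of Thm. 7.1 as Cor. 8.3 uses
it; `K` imaginary quadratic, `(f, d_K) = 1`, `3 ∤ d_K`, `ε_K` its Kronecker character (`IsKroneckerCharacterOf`); the two CM fields are
imaginary quadratic (`h⁻ = h`) with radicands, for `d = ψ(−1)·f`: `ψ` even — `f·d_K` and `−3f`; `ψ` odd — `−f` and `3·f·d_K`; «`3 ∤ h`» as
`ThreeClassNumberTrivial`; conclusion = hypothesis (4) of Thm. 7.1 in the currency of `thm120_padicLogHeegner_unit_of_bernoulli`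
(`bernoulliCharOne ψ εK = ψ₀⁻¹ε_K`, `bernoulliCharTwo ψ εK ω = ψ₀ω⁻¹`; quadratic characters are their own inverses).  Named fact
(PUBLISHED, refereed); nothing asserted; users take `(h : cor83_bernoulli_unit_three_of_h3)`.
-- TODO(general form): Lemma 8.2 for general `p ≥ 3` (relative class numbers of the abelian CM fields cut out by `ψ₀ε_K`, `ψ₀⁻¹ω`).
[cite: KrizLi2019, §8 (35), Lemma 8.2, Cor. 8.3 (Forum Math. Sigma 7 (2019) e15; = arXiv:1609.06687v3 ll. 818–867)]
[cite: Washington1997, Thm. 4.17 (the class number formula behind (35))] -/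
def cor83_bernoulli_unit_three_of_h3 : Prop :=
  ∀ (f : ℕ) [NeZero f] (ψ : DirichletCharacter ℚ_[3] f) (ω : DirichletCharacter ℚ_[3] 3),
    ψ.IsPrimitive → ψ ^ 2 = 1 → IsTeichmullerCharacter ω →
    -- «`ψ ≠ 1` or `ω`», as Cor. 8.3 obtains it: hypothesis (1) of Thm. 7.1, `ψ(3) ≠ 1` and `(ψ⁻¹ω)(3) ≠ 1`
    ψ ((3 : ℕ) : ZMod f) ≠ 1 → primVal (invMulOmega ψ ω) 3 ≠ 1 →
    ∀ (K : Type) [Field K] [NumberField K] [NeZero (NumberField.discr K).natAbs],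
      IsImaginaryQuadratic K → Nat.Coprime f (NumberField.discr K).natAbs → ¬ ((3 : ℤ) ∣ NumberField.discr K) →
    ∀ (εK : DirichletCharacter ℚ_[3] (NumberField.discr K).natAbs), IsKroneckerCharacterOf K εK →
      -- `3 ∤ h(K_{ψ₀ε_K}) · h(K_{ψ₀⁻¹ω})`, the two imaginary quadratic fields by the parity of `ψ` (`d = ψ(−1)·f`)
      (ψ.Even → ThreeClassNumberTrivial ((f : ℤ) * NumberField.discr K) ∧ ThreeClassNumberTrivial (-3 * (f : ℤ))) →
      (ψ.Odd → ThreeClassNumberTrivial (-(f : ℤ)) ∧ ThreeClassNumberTrivial (3 * (f : ℤ) * NumberField.discr K)) →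
      -- condition (4) of Thm. 7.1 at `p = 3`: `B_{1,ψ₀⁻¹ε_K} · B_{1,ψ₀ω⁻¹} ≢ 0 (mod 3)`
      ¬ (‖bernoulliOnePrim (bernoulliCharOne ψ εK) * bernoulliOnePrim (bernoulliCharTwo ψ εK ω)‖ ≤ ((3 : ℕ) : ℝ)⁻¹)

end Literature.NumberTheory.EllipticCurves.KrizLi2019

end
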